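import Mathlib
import HarnessLib
import Summits.Ventures.LatticeQCDFlow.Scoring.SplitChainTimeAverageResidual
import Summits.Ventures.LatticeQCDFlow.Scoring.RegenerativeStrongLaw
import Summits.Ventures.LatticeQCDFlow.Scoring.RegenerativeEstimator

/-!
# THE STRONG LAW (ERGODIC THEOREM) FOR TIME AVERAGES OF A DOEBLIN CHAIN, from any initial law:
# `(1/n) Σ_{t<n} f(X_t) → π(f)` almost surely

HONEST FRAMING: exact (Metropolis-corrected) sampling algorithms for lattice gauge theory;
figures of merit are autocorrelation/cost numbers at stated couplings and volumes; no
continuum-physics claim.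

Venture `LatticeQCDFlow` (cell pub-lqcd), topic `Scoring`; FANOUT row 8 (`s0-cpn-nemc`, GEN-18).
NEW WORK of the cell, not a published result; no definition is introduced.  Setting of
`Scoring/MarkovChainCLT.lean`: `κ` Markov with invariant probability `π`, `κ(x, ·) ≥ ε ν`
(`0 < ε < 1`), `|f| ≤ C` measurable.  THE THEOREM: for EVERY initial law `μ₀`, almost surely under
the chain's path law, `(1/n) Σ_{t<n} f(X_t) → π(f)` — the exact sampler's time averages are
strongly consistent from any start (no stationarity, no warm start).  Regenerative proof, all on
the tree: realise the chain as the state path of the split chain; pathwise,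
`Σ_{t<n} f̄(X_t) = Z_0 + Σ_{1 ≤ i ≤ K_{n−1}} Z_i − Q_n` (`Scoring/SplitChainTimeAverageResidual.lean`);
the centred tour sums obey the strong law `(1/k) Σ_{i≤k} Z_i → 0` (tours are i.i.d.,
`Scoring/RegenerativeStrongLaw.lean`, `Scoring/RegenerativeCLT.lean`) and `K_{n−1} → ∞`, `K_{n−1} ≤ n`,
so `(1/n) Σ_{i ≤ K_{n−1}} Z_i → 0`; the residual is at most `2C` times the length `N_{K_{n−1}}` of
the tour in progress, and `N_k / k → 0` by the strong law for tour lengths.  Printed counterpart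
NAMED ONLY: the ergodic theorem for positive Harris chains (Meyn–Tweedie 1993 Thm 17.0.1 (i);
Chung 1960 §I.15) — nothing is cited as a fact.

## Content (`π` invariant, `κ(x, ·) ≥ ε ν`, `0 < ε < 1`, `|f| ≤ C` measurable)

* **`splitChain_timeAverage_slln`** — for the split chain from any initial law on `Ω × Bool`:
  a.s. `(1/n) Σ_{t<n} (f(X_t) − π f) → 0`;
* **`markovChain_slln`** — THE THEOREM: for every initial law `μ₀`, `P_{μ₀}`-a.s.
  `(Σ_{t<n} f(x_t))/n → π(f)`.

NOT CLAIMED: a rate (law of the iterated logarithm); unbounded `f`; chains without a whole-space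
minorisation.
-/

noncomputable section

namespace Summit.Ventures.LatticeQCDFlow.Scoring

open MeasureTheory ProbabilityTheory Filter Finset Preorder Literature.Probability.MarkovChains
open scoped ENNReal Topology

section SLLN

variable {Ω : Type*} [MeasurableSpace Ω]
  {κ : Kernel Ω Ω} [IsMarkovKernel κ] {ν : Measure Ω} [IsProbabilityMeasure ν] {ε : ℝ≥0∞}
  {hmin : ∀ x {B : Set Ω}, MeasurableSet B → ε * ν B ≤ κ x B}
  (κs : Kernel (Ω × Bool) (Ω × Bool)) [IsMarkovKernel κs]
  (μs : Measure (Ω × Bool)) [IsProbabilityMeasure μs]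

/-- **STRONG LAW FOR THE TIME AVERAGE OF THE SPLIT CHAIN'S STATE PATH**, any initial law:
almost surely `(1/n) Σ_{t<n} (f(X_t) − π f) → 0`. -/
theorem splitChain_timeAverage_slln {π : Measure Ω} [IsProbabilityMeasure π]
    (hπ : Kernel.Invariant κ π) (hε0 : 0 < ε) (hε : ε < 1)
    (hκs : ∀ p, κs p = (ε • ν).map (fun y : Ω => (y, true))
      + ((1 - ε) • Doeblin.residualKernel κ ν ε hmin p.1).map (fun y : Ω => (y, false)))
    {f : Ω → ℝ} (hf : Measurable f) {C : ℝ} (hC : ∀ x, |f x| ≤ C) :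
    ∀ᵐ x ∂(Kernel.trajMeasure (X := fun _ : ℕ => Ω × Bool) μs
        (fun n : ℕ => κs.comap (fun h : (i : ↥(Finset.Iic n)) → Ω × Bool =>
          h ⟨n, Finset.mem_Iic.2 le_rfl⟩) (measurable_pi_apply _))),
      Tendsto (fun n : ℕ => (∑ t ∈ Finset.range n, (f (x t).1 - ∫ z, f z ∂π)) / n) atTop (𝓝 0) := by
  set P := (Kernel.trajMeasure (X := fun _ : ℕ => Ω × Bool) μs
        (fun n : ℕ => κs.comap (fun h : (i : ↥(Finset.Iic n)) → Ω × Bool =>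
          h ⟨n, Finset.mem_Iic.2 le_rfl⟩) (measurable_pi_apply _))) with hP
  set c := ∫ z, f z ∂π with hc
  have he0 : 0 < ε.toReal := ENNReal.toReal_pos hε0.ne' (ne_top_of_lt hε)
  obtain ⟨-, hCg, -⟩ := centred_observable_bounds π hf hC
  have hC0 : 0 ≤ C := (abs_nonneg _).trans (hC (Classical.choice (nonempty_of_isProbabilityMeasure π)))
  have hae := splitChain_ae_tourStart κs μs (κ := κ) (ν := ν) (hmin := hmin) hε0 hε hκs
  have hYs := splitChain_tourSum_strongLaw κs μs (κ := κ) (ν := ν) (hmin := hmin) hπ hε0 hε hκs hf hC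
  have hNs := splitChain_tourLength_strongLaw κs μs (κ := κ) (ν := ν) (hmin := hmin) hε0 hε hκs
  rw [← hP] at hae hYs hNs
  filter_upwards [hae, hYs, hNs] with x hx hYx hNx
  -- notation along this path
  set Zt : ℕ → ℝ := fun i => (∑' u, (if (∑ s ∈ Finset.range u, (if (x (s + 1)).2 then (1 : ℕ) else 0)) = i then (1 : ℝ) else 0) * (fun y : Ω => f y - c) (x u).1) with hZt
  set Nt : ℕ → ℝ := fun i => (∑' u, (if (∑ s ∈ Finset.range u, (if (x (s + 1)).2 then (1 : ℕ) else 0)) = i then (1 : ℝ) else 0)) with hNt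
  set Kt : ℕ → ℕ := fun n => (∑ s ∈ Finset.range (n - 1), (if (x (s + 1)).2 then (1 : ℕ) else 0)) with hKt
  -- (1) the averages of the centred tour sums tend to `0`
  have hZ : ∀ i : ℕ, Zt (i + 1) = (∑' u, (if (∑ s ∈ Finset.range u, (if (x (s + 1)).2 then (1 : ℕ) else 0)) = i + 1 then (1 : ℝ) else 0) * f (x u).1) - c * Nt (i + 1) := fun i => by
    obtain ⟨t₁, ht₁, hh₁⟩ := hx (i + 1)
    simp only [hZt, hNt]
    rw [tourSum_eq_finsetSum (fun p _ => f p.1 - c) x le_rfl ht₁ hh₁,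
      tourSum_eq_finsetSum (fun p _ => f p.1) x le_rfl ht₁ hh₁,
      tourLength_eq_finsetSum x le_rfl ht₁ hh₁, Finset.mul_sum, ← Finset.sum_sub_distrib]
    exact Finset.sum_congr rfl fun u _ => by ring
  have havgZ : Tendsto (fun k : ℕ => (∑ i ∈ Finset.range k, Zt (i + 1)) / k) atTop (𝓝 0) := by
    have h := hYx.sub (hNx.const_mul c)
    rw [show c / ε.toReal - c * (1 / ε.toReal) = 0 by ring] at h
    refine h.congr fun k => ?_
    rw [Finset.sum_congr rfl fun i _ => hZ i, Finset.sum_sub_distrib, ← Finset.mul_sum, sub_div,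
      mul_div_assoc]
  -- (2) `K_{n−1} → ∞`
  have hK : Tendsto Kt atTop atTop := by
    refine tendsto_atTop_atTop.2 fun k => ?_
    obtain ⟨t, ht, hht⟩ := hx k
    refine ⟨t + 2, fun n hn => ?_⟩
    have h1 := headCount_mono x (show t + 1 ≤ n - 1 by omega)
    rw [headCount_succ, ht, hht] at h1
    simp only [if_true] at h1
    simp only [hKt]
    omega
  -- (3) the tour lengths: `N_k / k → 0`, hence `N_{K_{n−1}} / n → 0`
  have hNk : Tendsto (fun k : ℕ => Nt k / k) atTop (𝓝 0) := by
    -- `N_{k+1} = (k+1) avg_{k+1} − k avg_k`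
    have h1 : Tendsto (fun k : ℕ => (∑ i ∈ Finset.range (k + 1), Nt (i + 1)) / (k + 1 : ℕ)) atTop
        (𝓝 (1 / ε.toReal)) := hNx.comp (tendsto_add_atTop_nat 1)
    have h2 : Tendsto (fun k : ℕ => ((k : ℝ) / (k + 1 : ℕ)) * ((∑ i ∈ Finset.range k, Nt (i + 1)) / k))
        atTop (𝓝 (1 * (1 / ε.toReal))) := by
      refine Tendsto.mul ?_ hNx
      have : Tendsto (fun k : ℕ => ((k : ℝ) + 1)⁻¹ * (k : ℝ)) atTop (𝓝 1) := by
        have h := tendsto_natCast_div_add_atTop (1 : ℝ)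
        refine h.congr fun k => ?_
        rw [div_eq_inv_mul]
      refine this.congr fun k => ?_
      push_cast
      rw [div_eq_inv_mul]
    have h3 := h1.sub h2
    rw [one_mul, sub_self] at h3
    have h4 : Tendsto (fun k : ℕ => Nt (k + 1) / (k + 1 : ℕ)) atTop (𝓝 0) := by
      refine h3.congr fun k => ?_
      rw [Finset.sum_range_succ]
      rcases Nat.eq_zero_or_pos k with hk | hk
      · subst hk; simp
      · have hk0 : (k : ℝ) ≠ 0 := (Nat.cast_pos.2 hk).ne'
        field_simp
        ring
    exact (tendsto_add_atTop_iff_nat 1).1 h4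
  have hNt0 : ∀ i, 0 ≤ Nt i := fun i => tsum_nonneg fun u => by split_ifs <;> norm_num
  have hKle : ∀ n, Kt n ≤ n := fun n => by
    simp only [hKt]
    calc (∑ s ∈ Finset.range (n - 1), (if (x (s + 1)).2 then (1 : ℕ) else 0)) ≤ ∑ s ∈ Finset.range (n - 1), 1 :=
        Finset.sum_le_sum fun s _ => by split_ifs <;> norm_num
      _ ≤ n := by simp
  have hNK : Tendsto (fun n : ℕ => Nt (Kt n) / n) atTop (𝓝 0) := by
    have h := hNk.comp hK
    refine squeeze_zero' (Eventually.of_forall fun n => div_nonneg (hNt0 _) (Nat.cast_nonneg n)) ?_ h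
    filter_upwards [hK.eventually_ge_atTop 1] with n hn
    simp only [Function.comp_apply]
    exact div_le_div_of_nonneg_left (hNt0 _) (Nat.cast_pos.2 (by omega)) (Nat.cast_le.2 (hKle n))
  -- (4) assemble: for `n ≥ 1`, `|Σ_{t<n} f̄ / n| ≤ |Z_0|/n + |avg_{K} Z| + 2C N_{K} / n`
  have hZ0 : Tendsto (fun n : ℕ => |Zt 0| / n) atTop (𝓝 0) := tendsto_const_div_atTop_nhds_zero_nat _
  have havgK : Tendsto (fun n : ℕ => |(∑ i ∈ Finset.range (Kt n), Zt (i + 1)) / (Kt n)|) atTop (𝓝 0) := by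
    have h := (havgZ.comp hK).abs
    rw [abs_zero] at h
    exact h
  have hsum3 : Tendsto (fun n : ℕ => |Zt 0| / n + |(∑ i ∈ Finset.range (Kt n), Zt (i + 1)) / (Kt n)|
      + 2 * C * (Nt (Kt n) / n)) atTop (𝓝 0) := by
    have h := (hZ0.add havgK).add (hNK.const_mul (2 * C))
    rw [add_zero, mul_zero, add_zero] at h
    exact h
  refine squeeze_zero_norm' ?_ hsum3
  filter_upwards [eventually_gt_atTop 0] with n hn
  have hn0 : (0 : ℝ) < n := Nat.cast_pos.2 hn
  obtain ⟨T, hnT, hT, hhT, hres, hQ, hident⟩ :=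
    timeSum_eq_tourSums_sub_residual (fun y => f y - c) x hx hn
  -- residual bound: `|Q_n| ≤ 2C (T + 1 − n) ≤ 2C N_{K_{n−1}}`
  have hQb : |∑ u ∈ Finset.Ico n (T + 1), (f (x u).1 - c)| ≤ 2 * C * Nt (Kt n) := by
    refine (abs_sum_Ico_le (g := fun y => f y - c) hCg x n T).trans ?_
    refine mul_le_mul_of_nonneg_left ?_ (by positivity)
    -- `T + 1 − n ≤ #[n−1, T] ≤ N_{K_{n−1}}`
    have hNfin : Nt (Kt n) = ∑ u ∈ Finset.range (T + 1), (if (∑ s ∈ Finset.range u, (if (x (s + 1)).2 then (1 : ℕ) else 0)) = Kt n then (1 : ℝ) else 0) := by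
      simp only [hNt, hKt]
      exact tourLength_eq_finsetSum x le_rfl hT hhT
    rw [hNfin]
    have hsub : Finset.Icc (n - 1) T ⊆ Finset.range (T + 1) := fun u hu => by
      rw [Finset.mem_Icc] at hu; exact Finset.mem_range.2 (by omega)
    calc ((T + 1 - n : ℕ) : ℝ) ≤ ((Finset.Icc (n - 1) T).card : ℝ) := by
          rw [Nat.card_Icc]; exact_mod_cast (by omega : T + 1 - n ≤ T + 1 - (n - 1))
      _ = ∑ u ∈ Finset.Icc (n - 1) T, (1 : ℝ) := by simp
      _ = ∑ u ∈ Finset.Icc (n - 1) T, (if (∑ s ∈ Finset.range u, (if (x (s + 1)).2 then (1 : ℕ) else 0)) = Kt n then (1 : ℝ) else 0) := by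
          refine Finset.sum_congr rfl fun u hu => ?_
          rw [Finset.mem_Icc] at hu
          rw [if_pos]
          simp only [hKt]
          rcases Nat.eq_or_lt_of_le hu.1 with h | h
          · rw [h]
          · exact (hres u (by omega)).2 hu.2
      _ ≤ _ := Finset.sum_le_sum_of_subset_of_nonneg hsub fun u _ _ => by split_ifs <;> norm_num
  -- the middle term: `|Σ_{i<K} Z_{i+1}| / n ≤ |avg_K|`
  have hmid : |∑ i ∈ Finset.range (Kt n), Zt (i + 1)| / n
      ≤ |(∑ i ∈ Finset.range (Kt n), Zt (i + 1)) / (Kt n)| := by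
    rcases Nat.eq_zero_or_pos (Kt n) with hk | hk
    · rw [hk]; simp
    · have hk0 : (0 : ℝ) < Kt n := Nat.cast_pos.2 hk
      rw [abs_div, abs_of_pos hk0]
      exact div_le_div_of_nonneg_left (abs_nonneg _) hk0 (Nat.cast_le.2 (hKle n))
  -- put together
  rw [Real.norm_eq_abs, hident, hQ, Finset.sum_range_succ']
  simp only [hZt] at hmid ⊢
  have htri : ∀ a b q : ℝ, |(b + a - q) / n| ≤ |a| / n + |b| / n + |q| / n := by
    intro a b q
    rw [abs_div, abs_of_pos hn0, ← add_div, ← add_div]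
    refine div_le_div_of_nonneg_right ?_ hn0.le
    calc |b + a - q| ≤ |b + a| + |q| := abs_sub _ _
      _ ≤ |b| + |a| + |q| := by gcongr; exact abs_add_le _ _
      _ = |a| + |b| + |q| := by ring
  refine (htri _ _ _).trans (add_le_add (add_le_add le_rfl hmid) ?_)
  calc |∑ u ∈ Finset.Ico n (T + 1), (f (x u).1 - c)| / n ≤ 2 * C * Nt (Kt n) / n :=
      div_le_div_of_nonneg_right hQb hn0.le
    _ = 2 * C * (Nt (Kt n) / n) := by ring

/-- **THE STRONG LAW FOR TIME AVERAGES OF A DOEBLIN CHAIN, FROM ANY INITIAL LAW.**  `κ` Markov with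
invariant probability `π`, `κ(x, ·) ≥ ε ν` (`0 < ε < 1`), `|f| ≤ C` measurable, `μ₀` ANY initial law:
`P_{μ₀}`-almost surely, `(Σ_{t<n} f(x_t))/n → π(f)`. -/
theorem markovChain_slln {π : Measure Ω} [IsProbabilityMeasure π]
    (hπ : Kernel.Invariant κ π) (hmin : ∀ x {B : Set Ω}, MeasurableSet B → ε * ν B ≤ κ x B)
    (hε0 : 0 < ε) (hε : ε < 1)
    {f : Ω → ℝ} (hf : Measurable f) {C : ℝ} (hC : ∀ x, |f x| ≤ C)
    (μ₀ : Measure Ω) [IsProbabilityMeasure μ₀] :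
    ∀ᵐ y ∂(Kernel.trajMeasure (X := fun _ : ℕ => Ω) μ₀
        (fun n : ℕ => κ.comap (fun h : (i : ↥(Finset.Iic n)) → Ω => h ⟨n, Finset.mem_Iic.2 le_rfl⟩)
          (measurable_pi_apply _))),
      Tendsto (fun n : ℕ => (∑ t ∈ Finset.range n, f (y t)) / n) atTop (𝓝 (∫ z, f z ∂π)) := by
  obtain ⟨κs, hκsM, hκs⟩ := exists_splitKernel (κ := κ) (ν := ν) (hmin := hmin) hε
  set μs : Measure (Ω × Bool) := μ₀.map (fun y : Ω => (y, true)) with hμs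
  haveI : IsProbabilityMeasure μs := Measure.isProbabilityMeasure_map (measurable_tagCoin true).aemeasurable
  set c := ∫ z, f z ∂π with hc
  have h := splitChain_timeAverage_slln κs μs (κ := κ) (ν := ν) (hmin := hmin) hπ hε0 hε hκs hf hC
  -- un-centre: `(Σ f)/n = (Σ (f − c))/n + c` for `n ≥ 1`
  have h' : ∀ᵐ x ∂(Kernel.trajMeasure (X := fun _ : ℕ => Ω × Bool) μs
        (fun n : ℕ => κs.comap (fun h : (i : ↥(Finset.Iic n)) → Ω × Bool =>
          h ⟨n, Finset.mem_Iic.2 le_rfl⟩) (measurable_pi_apply _))),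
      Tendsto (fun n : ℕ => (∑ t ∈ Finset.range n, f (x t).1) / n) atTop (𝓝 c) := by
    filter_upwards [h] with x hx
    have h2 := hx.add_const c
    rw [zero_add] at h2
    refine h2.congr' ?_
    filter_upwards [eventually_gt_atTop 0] with n hn
    have hn0 : (n : ℝ) ≠ 0 := (Nat.cast_pos.2 hn).ne'
    rw [Finset.sum_sub_distrib, Finset.sum_const, Finset.card_range, nsmul_eq_mul]
    field_simp
    ring
  -- transfer through the state-path map (identity of path laws)
  have hfst : μs.map Prod.fst = μ₀ := by
    rw [hμs, Measure.map_map measurable_fst (measurable_tagCoin true)]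
    exact Measure.map_id
  have hlaw := splitChain_map_fst κs μs (κ := κ) (ν := ν) (hmin := hmin) hε hκs
  rw [hfst] at hlaw
  have hstate : Measurable (fun (x : ℕ → Ω × Bool) (n : ℕ) => (x n).1) :=
    measurable_pi_lambda _ fun n => measurable_fst.comp (measurable_pi_apply n)
  have hGm : ∀ n : ℕ, Measurable fun y : ℕ → Ω => (∑ t ∈ Finset.range n, f (y t)) / n := fun n =>
    (Finset.measurable_sum _ fun t _ => hf.comp (measurable_pi_apply t)).div_const _
  have hS : MeasurableSet {y : ℕ → Ω |
      Tendsto (fun n : ℕ => (∑ t ∈ Finset.range n, f (y t)) / n) atTop (𝓝 c)} :=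
    measurableSet_tendsto (𝓝 c) hGm
  rw [← hlaw]
  exact (ae_map_iff hstate.aemeasurable hS).2 h'

end SLLN

end Summit.Ventures.LatticeQCDFlow.Scoring

end
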